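import Mathlib
import HarnessLib
import Summits.AtomisticToContinuum.FouriersLaw.Theses.JunctionLocality
import Summits.AtomisticToContinuum.FouriersLaw.Theorems.JunctionLocalitySuperadditiveResistanceDeviceLiouville
import Summits.AtomisticToContinuum.FouriersLaw.Theorems.JunctionLocalitySuperadditiveResistancePlainAdjoint
import Summits.AtomisticToContinuum.FouriersLaw.Theorems.JunctionLocalitySuperadditiveResistanceStubDeviceForwardFieldsAux1
import Literature.Analysis.Distribution.Hypoelliptic

/-!
# Forward fields of the γ-probed device, II: the bracket condition and the `μ_T`-adjoint for general site weights
(helper toward stub `stub_deviceForwardFields` of line `floating-probe-bypass-laplacian`,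
crux stmt-AtomisticToContinuum-11748; Part II of six, see Part I `…StubDeviceForwardFieldsAux1`
for the overview)

* Cuneo–Eckmann–Hairer–Rey-Bellet 2018, Prop. 4.1, for the family `(X₀; X_i)` of Part I (explicit
  terms, no definitions; the brackets `Z_k` are the iterates `([X₀, ·])^[k] X_{0}`) (`X₀ = σ X_H + c (0, B ⊙ p)`, `X_i = √(cTB_i) ∂_{p_i}`): for smooth potentials with
  `V″ ≠ 0` everywhere, `σ ≠ 0` and `c T B_0 > 0` (a genuine thermostat on the first momentum),
  the iterated brackets `Z_0 = X_0`, `Z_{k+1} = [X₀, Z_k]` have the triangular structure of the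
  chain (`genBracketSeq_triangular`: ranks `p_0 ≺ q_0 ≺ p_1 ≺ ⋯`, rank-`k` coordinate of `Z_k`
  nowhere zero — it is `±σ^k √(cTB_0) ∏ V″`) and hence span phase space at every point
  (`isBracketGenerating_genFamily`). The anti-friction part of `X₀` is diagonal in the momenta
  and does not disturb the triangular induction. Adapted line by line from
  `OscillatorChain.bracketSeq_triangular` / `isBracketGenerating_hormanderFamily`
  (`LangevinChainHormander.lean`, the case `σ = −1`, `B = bathWeight`).
* `integral_genOp_mul_eq_adjoint` — `∫ (σ X_H f + c S_B f + κ f) g ρ_T = ∫ f (−σ X_H g + c S_B g + κ g) ρ_T`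
  for `f ∈ C²_c`, `g ∈ C²`, any `OscillatorChain` with `C¹` potentials, `T ≠ 0`, any weights `B`,
  any constant `κ` (the `μ_T`-adjoint of `σ X_H + c S_B + κ` on smooth functions is
  `−σ X_H + c S_B + κ`; adapted from `integral_generator_mul_eq_adjoint`, the case `B = bathWeight`).
Axioms: `propext`, `Classical.choice`, `Quot.sound`.
-/

noncomputable section

open MeasureTheory Filter Topology
open scoped ContDiff
open Literature.MathematicalPhysics.KineticTheory.HeatConduction
open Summit.AtomisticToContinuum.FouriersLaw.Theorems.SuperadditiveResistance.DeviceLiouville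

namespace Summit.AtomisticToContinuum.FouriersLaw.Cruxes.SuperadditiveResistance.FloatingProbeBypassLaplacian

open Literature.Analysis.Distribution

variable {L : ℕ} (P : OscillatorChain)

/-! Terms (no definitions): `X₀ = fun x => σ • hamField P L x + c • (0, B * x.2)`,
`X = fun i _ => √(cTB_i) • unitP i`, the family `fun o => o.elim X₀ X`, and the brackets
`Z_k = ([X₀, ·])^[k] (X ⟨0, hL⟩)` (`VectorField.lieBracket` iterated). -/

/-! ## The bracket condition for `(X₀; X_i)` (CEHR Prop. 4.1, general site weights) -/

section Brackets

variable {P} (hL : 0 < L) (σ c T : ℝ) (B : Fin L → ℝ)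

/-- Each `Z_k` is an iterated Lie bracket of the family `(X₀; X_i)`. [folklore] -/
theorem isIteratedLieBracket_genBracketSeq (k : ℕ) :
    IsIteratedLieBracket ((fun o : Option (Fin L) => Option.elim o (fun x : PhaseSpace L => σ • hamField P L x + c • (((0 : Fin L → ℝ), B * Prod.snd x) : PhaseSpace L)) (fun (i : Fin L) (_x : PhaseSpace L) => Real.sqrt (c * T * B i) • (unitP i : PhaseSpace L)))) (((VectorField.lieBracket ℝ (fun x : PhaseSpace L => σ • hamField P L x + c • (((0 : Fin L → ℝ), B * Prod.snd x) : PhaseSpace L)))^[k] ((fun (i : Fin L) (_x : PhaseSpace L) => Real.sqrt (c * T * B i) • (unitP i : PhaseSpace L)) ⟨0, hL⟩))) := by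
  induction k with
  | zero => exact IsIteratedLieBracket.of (some (⟨0, hL⟩ : Fin L))
  | succ k ih =>
    rw [Function.iterate_succ_apply']
    exact IsIteratedLieBracket.lieBracket none ih

/-- The recursion `Z_{k+1}(x) = DZ_k(x)·X₀(x) − DX₀(x)·Z_k(x)`. [folklore] -/
theorem genBracketSeq_succ_apply (k : ℕ) (x : PhaseSpace L) :
    ((VectorField.lieBracket ℝ (fun x : PhaseSpace L => σ • hamField P L x + c • (((0 : Fin L → ℝ), B * Prod.snd x) : PhaseSpace L)))^[k + 1] ((fun (i : Fin L) (_x : PhaseSpace L) => Real.sqrt (c * T * B i) • (unitP i : PhaseSpace L)) ⟨0, hL⟩)) x =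
      fderiv ℝ (((VectorField.lieBracket ℝ (fun x : PhaseSpace L => σ • hamField P L x + c • (((0 : Fin L → ℝ), B * Prod.snd x) : PhaseSpace L)))^[k] ((fun (i : Fin L) (_x : PhaseSpace L) => Real.sqrt (c * T * B i) • (unitP i : PhaseSpace L)) ⟨0, hL⟩))) x
          (σ • hamField P L x + c • (((0 : Fin L → ℝ), B * x.2) : PhaseSpace L)) -
        fderiv ℝ ((fun x : PhaseSpace L => σ • hamField P L x + c • (((0 : Fin L → ℝ), B * Prod.snd x) : PhaseSpace L))) x (((VectorField.lieBracket ℝ (fun x : PhaseSpace L => σ • hamField P L x + c • (((0 : Fin L → ℝ), B * Prod.snd x) : PhaseSpace L)))^[k] ((fun (i : Fin L) (_x : PhaseSpace L) => Real.sqrt (c * T * B i) • (unitP i : PhaseSpace L)) ⟨0, hL⟩)) x) := by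
  rw [Function.iterate_succ_apply', VectorField.lieBracket_eq]

/-- **Triangular structure of the brackets** (ranks `p_0 ≺ q_0 ≺ p_1 ≺ q_1 ≺ ⋯`): `Z_k` is smooth,
its coordinates of rank `> k` vanish identically and its rank-`k` coordinate vanishes nowhere
(it is `±σ^k √(cTB_0) ∏ V''`), provided `σ ≠ 0`, `c T B_0 > 0`, `V'' ≠ 0`.
(adapted from `OscillatorChain.bracketSeq_triangular`) [folklore] -/
theorem genBracketSeq_triangular (hU : ContDiff ℝ ∞ P.U) (hV : ContDiff ℝ ∞ P.V) (hσ : σ ≠ 0)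
    (hB0 : 0 < c * T * B ⟨0, hL⟩) (hV2 : ∀ r, deriv (deriv P.V) r ≠ 0) (k : ℕ) :
    ContDiff ℝ ∞ (((VectorField.lieBracket ℝ (fun x : PhaseSpace L => σ • hamField P L x + c • (((0 : Fin L → ℝ), B * Prod.snd x) : PhaseSpace L)))^[k] ((fun (i : Fin L) (_x : PhaseSpace L) => Real.sqrt (c * T * B i) • (unitP i : PhaseSpace L)) ⟨0, hL⟩))) ∧
    (∀ i : Fin L, k < 2 * i.val → ∀ x, (((VectorField.lieBracket ℝ (fun x : PhaseSpace L => σ • hamField P L x + c • (((0 : Fin L → ℝ), B * Prod.snd x) : PhaseSpace L)))^[k] ((fun (i : Fin L) (_x : PhaseSpace L) => Real.sqrt (c * T * B i) • (unitP i : PhaseSpace L)) ⟨0, hL⟩)) x).2 i = 0) ∧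
    (∀ i : Fin L, k < 2 * i.val + 1 → ∀ x, (((VectorField.lieBracket ℝ (fun x : PhaseSpace L => σ • hamField P L x + c • (((0 : Fin L → ℝ), B * Prod.snd x) : PhaseSpace L)))^[k] ((fun (i : Fin L) (_x : PhaseSpace L) => Real.sqrt (c * T * B i) • (unitP i : PhaseSpace L)) ⟨0, hL⟩)) x).1 i = 0) ∧
    (∀ i : Fin L, k = 2 * i.val → ∀ x, (((VectorField.lieBracket ℝ (fun x : PhaseSpace L => σ • hamField P L x + c • (((0 : Fin L → ℝ), B * Prod.snd x) : PhaseSpace L)))^[k] ((fun (i : Fin L) (_x : PhaseSpace L) => Real.sqrt (c * T * B i) • (unitP i : PhaseSpace L)) ⟨0, hL⟩)) x).2 i ≠ 0) ∧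
    (∀ i : Fin L, k = 2 * i.val + 1 → ∀ x, (((VectorField.lieBracket ℝ (fun x : PhaseSpace L => σ • hamField P L x + c • (((0 : Fin L → ℝ), B * Prod.snd x) : PhaseSpace L)))^[k] ((fun (i : Fin L) (_x : PhaseSpace L) => Real.sqrt (c * T * B i) • (unitP i : PhaseSpace L)) ⟨0, hL⟩)) x).1 i ≠ 0) := by
  induction k with
  | zero =>
    refine ⟨contDiff_const, fun i hi x => ?_, fun i _ x => ?_, fun i hi x => ?_, fun i hi _ => ?_⟩
    · have hi0 : i ≠ ⟨0, hL⟩ := by intro e; subst e; simp at hi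
      simp [hi0]
    · simp
    · have hi0 : i = ⟨0, hL⟩ := Fin.ext (by change i.val = 0; omega)
      subst hi0
      simp [Real.sqrt_ne_zero'.2 hB0]
    · omega
  | succ k ih =>
    obtain ⟨h1, h2, h3, h4, h5⟩ := ih
    have hrec := genBracketSeq_succ_apply (P := P) hL σ c T B k
    -- components of the recursion
    have hfst : ∀ x i, (((VectorField.lieBracket ℝ (fun x : PhaseSpace L => σ • hamField P L x + c • (((0 : Fin L → ℝ), B * Prod.snd x) : PhaseSpace L)))^[k + 1] ((fun (i : Fin L) (_x : PhaseSpace L) => Real.sqrt (c * T * B i) • (unitP i : PhaseSpace L)) ⟨0, hL⟩)) x).1 i =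
        (fderiv ℝ (((VectorField.lieBracket ℝ (fun x : PhaseSpace L => σ • hamField P L x + c • (((0 : Fin L → ℝ), B * Prod.snd x) : PhaseSpace L)))^[k] ((fun (i : Fin L) (_x : PhaseSpace L) => Real.sqrt (c * T * B i) • (unitP i : PhaseSpace L)) ⟨0, hL⟩))) x
          (σ • hamField P L x + c • (((0 : Fin L → ℝ), B * x.2) : PhaseSpace L))).1 i -
          σ * (((VectorField.lieBracket ℝ (fun x : PhaseSpace L => σ • hamField P L x + c • (((0 : Fin L → ℝ), B * Prod.snd x) : PhaseSpace L)))^[k] ((fun (i : Fin L) (_x : PhaseSpace L) => Real.sqrt (c * T * B i) • (unitP i : PhaseSpace L)) ⟨0, hL⟩)) x).2 i := fun x i => by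
      rw [hrec, fderiv_genDrift_apply hU hV]
      simp
    have hsnd : ∀ x i, (((VectorField.lieBracket ℝ (fun x : PhaseSpace L => σ • hamField P L x + c • (((0 : Fin L → ℝ), B * Prod.snd x) : PhaseSpace L)))^[k + 1] ((fun (i : Fin L) (_x : PhaseSpace L) => Real.sqrt (c * T * B i) • (unitP i : PhaseSpace L)) ⟨0, hL⟩)) x).2 i =
        (fderiv ℝ (((VectorField.lieBracket ℝ (fun x : PhaseSpace L => σ • hamField P L x + c • (((0 : Fin L → ℝ), B * Prod.snd x) : PhaseSpace L)))^[k] ((fun (i : Fin L) (_x : PhaseSpace L) => Real.sqrt (c * T * B i) • (unitP i : PhaseSpace L)) ⟨0, hL⟩))) x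
          (σ • hamField P L x + c • (((0 : Fin L → ℝ), B * x.2) : PhaseSpace L))).2 i -
          (-(σ * ∑ j, P.hessPotential L i j x.1 * (((VectorField.lieBracket ℝ (fun x : PhaseSpace L => σ • hamField P L x + c • (((0 : Fin L → ℝ), B * Prod.snd x) : PhaseSpace L)))^[k] ((fun (i : Fin L) (_x : PhaseSpace L) => Real.sqrt (c * T * B i) • (unitP i : PhaseSpace L)) ⟨0, hL⟩)) x).1 j) +
            c * (B i * (((VectorField.lieBracket ℝ (fun x : PhaseSpace L => σ • hamField P L x + c • (((0 : Fin L → ℝ), B * Prod.snd x) : PhaseSpace L)))^[k] ((fun (i : Fin L) (_x : PhaseSpace L) => Real.sqrt (c * T * B i) • (unitP i : PhaseSpace L)) ⟨0, hL⟩)) x).2 i)) := fun x i => by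
      rw [hrec, fderiv_genDrift_apply hU hV]
      rfl
    refine ⟨?_, fun i hi x => ?_, fun i hi x => ?_, fun i hi x => ?_, fun i hi x => ?_⟩
    · -- smoothness
      rw [Function.iterate_succ_apply']
      exact (contDiff_genDrift hU hV L σ c B).lieBracket_vectorField h1
        (by exact_mod_cast le_top)
    · -- vanishing of the `p_i` coordinate for `k + 1 < 2 i`
      rw [hsnd, fderiv_apply_snd_eq_zero (h2 i (by omega)), h2 i (by omega) x, mul_zero,
        mul_zero, add_zero, zero_sub, neg_neg, mul_eq_zero]
      refine Or.inr (Finset.sum_eq_zero fun j _ => ?_)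
      by_cases hj : k < 2 * j.val + 1
      · rw [h3 j hj x, mul_zero]
      · rw [P.hessPotential_eq_zero_of_le L (by omega) x.1, zero_mul]
    · -- vanishing of the `q_i` coordinate for `k + 1 < 2 i + 1`
      rw [hfst, fderiv_apply_fst_eq_zero (h3 i (by omega)), h2 i (by omega) x, mul_zero, sub_zero]
    · -- non-vanishing of the `p_i` coordinate for `k + 1 = 2 i` (`i ≥ 1`)
      have hi1 : 1 ≤ i.val := by omega
      set i' : Fin L := ⟨i.val - 1, by omega⟩ with hi'
      rw [hsnd, fderiv_apply_snd_eq_zero (h2 i (by omega)), h2 i (by omega) x, mul_zero,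
        mul_zero, add_zero, zero_sub, neg_neg, Finset.sum_eq_single_of_mem i' (Finset.mem_univ _)]
      · refine mul_ne_zero hσ (mul_ne_zero ?_ (h5 i' (by simp [hi']; omega) x))
        rw [P.hessPotential_succ L (by simp [hi']; omega)]
        exact neg_ne_zero.2 (hV2 _)
      · intro j _ hj
        by_cases hjk : k < 2 * j.val + 1
        · rw [h3 j hjk x, mul_zero]
        · have : j.val + 2 ≤ i.val := by
            have : j.val ≠ i.val - 1 := fun e => hj (Fin.ext (by simp [hi', e]))
            omega
          rw [P.hessPotential_eq_zero_of_le L this x.1, zero_mul]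
    · -- non-vanishing of the `q_i` coordinate for `k + 1 = 2 i + 1`
      rw [hfst, fderiv_apply_fst_eq_zero (h3 i (by omega)), zero_sub, neg_ne_zero]
      exact mul_ne_zero hσ (h4 i (by omega) x)

/-- **The bracket condition for `(X₀; X_i)`, general site weights** (CEHR 2018 Prop. 4.1: a chain
with non-degenerate interaction is controlled by a thermostat on its first momentum): for smooth
potentials with `V'' ≠ 0` everywhere, `σ ≠ 0` and `c T B_0 > 0`, the iterated brackets of
the family `(X₀; X_i)` span phase space at every point. (adapted from
`OscillatorChain.isBracketGenerating_hormanderFamily`) [folklore] -/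
theorem isBracketGenerating_genFamily (hU : ContDiff ℝ ∞ P.U) (hV : ContDiff ℝ ∞ P.V)
    (hσ : σ ≠ 0) (hB0 : 0 < c * T * B ⟨0, hL⟩) (hV2 : ∀ r, deriv (deriv P.V) r ≠ 0) :
    IsBracketGenerating ((fun o : Option (Fin L) => Option.elim o (fun x : PhaseSpace L => σ • hamField P L x + c • (((0 : Fin L → ℝ), B * Prod.snd x) : PhaseSpace L)) (fun (i : Fin L) (_x : PhaseSpace L) => Real.sqrt (c * T * B i) • (unitP i : PhaseSpace L)))) Set.univ := by
  intro x _
  set S : Submodule ℝ (PhaseSpace L) := Submodule.span ℝ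
    {v | ∃ V, IsIteratedLieBracket ((fun o : Option (Fin L) => Option.elim o (fun x : PhaseSpace L => σ • hamField P L x + c • (((0 : Fin L → ℝ), B * Prod.snd x) : PhaseSpace L)) (fun (i : Fin L) (_x : PhaseSpace L) => Real.sqrt (c * T * B i) • (unitP i : PhaseSpace L)))) V ∧ V x = v} with hS
  have hZ : ∀ k, S.mkQ (((VectorField.lieBracket ℝ (fun x : PhaseSpace L => σ • hamField P L x + c • (((0 : Fin L → ℝ), B * Prod.snd x) : PhaseSpace L)))^[k] ((fun (i : Fin L) (_x : PhaseSpace L) => Real.sqrt (c * T * B i) • (unitP i : PhaseSpace L)) ⟨0, hL⟩)) x) = 0 := fun k => by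
    rw [Submodule.mkQ_apply, Submodule.Quotient.mk_eq_zero]
    exact Submodule.subset_span ⟨_, isIteratedLieBracket_genBracketSeq hL σ c T B k, rfl⟩
  have hT := genBracketSeq_triangular hL σ c T B hU hV hσ hB0 hV2
  -- every coordinate vector is in `S`, by strong induction on the site index
  have key : ∀ m : ℕ, ∀ i : Fin L, i.val = m → S.mkQ (unitP i) = 0 ∧ S.mkQ (unitQ i) = 0 := by
    intro m
    induction m using Nat.strong_induction_on with
    | _ m ih =>
      intro i him
      have hexp : ∀ k, (∑ j, (((VectorField.lieBracket ℝ (fun x : PhaseSpace L => σ • hamField P L x + c • (((0 : Fin L → ℝ), B * Prod.snd x) : PhaseSpace L)))^[k] ((fun (i : Fin L) (_x : PhaseSpace L) => Real.sqrt (c * T * B i) • (unitP i : PhaseSpace L)) ⟨0, hL⟩)) x).1 j • S.mkQ (unitQ j)) +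
          ∑ j, (((VectorField.lieBracket ℝ (fun x : PhaseSpace L => σ • hamField P L x + c • (((0 : Fin L → ℝ), B * Prod.snd x) : PhaseSpace L)))^[k] ((fun (i : Fin L) (_x : PhaseSpace L) => Real.sqrt (c * T * B i) • (unitP i : PhaseSpace L)) ⟨0, hL⟩)) x).2 j • S.mkQ (unitP j) = 0 := fun k => by
        have := hZ k
        rw [eq_sum_unitQ_add_sum_unitP (((VectorField.lieBracket ℝ (fun x : PhaseSpace L => σ • hamField P L x + c • (((0 : Fin L → ℝ), B * Prod.snd x) : PhaseSpace L)))^[k] ((fun (i : Fin L) (_x : PhaseSpace L) => Real.sqrt (c * T * B i) • (unitP i : PhaseSpace L)) ⟨0, hL⟩)) x)] at this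
        simpa only [map_add, map_sum, map_smul] using this
      -- the `p_i` direction, from `Z_{2m}`
      have hPi : S.mkQ (unitP i) = 0 := by
        obtain ⟨-, h2, h3, h4, -⟩ := hT (2 * m)
        have e := hexp (2 * m)
        rw [Finset.sum_eq_zero, zero_add, Finset.sum_eq_single_of_mem i (Finset.mem_univ _)] at e
        · exact (smul_eq_zero.1 e).resolve_left (h4 i (by omega) x)
        · intro j _ hj
          by_cases hjm : 2 * m < 2 * j.val
          · rw [h2 j hjm x, zero_smul]
          · rw [(ih j.val (by have : j.val ≠ m := fun e => hj (Fin.ext (by omega)); omega)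
              j rfl).1, smul_zero]
        · intro j _
          by_cases hjm : 2 * m < 2 * j.val + 1
          · rw [h3 j hjm x, zero_smul]
          · rw [(ih j.val (by omega) j rfl).2, smul_zero]
      refine ⟨hPi, ?_⟩
      -- the `q_i` direction, from `Z_{2m+1}`
      obtain ⟨-, h2, h3, -, h5⟩ := hT (2 * m + 1)
      have e := hexp (2 * m + 1)
      rw [Finset.sum_eq_single_of_mem i (Finset.mem_univ _), Finset.sum_eq_zero, add_zero] at e
      · exact (smul_eq_zero.1 e).resolve_left (h5 i (by omega) x)
      · intro j _
        by_cases hjm : 2 * m + 1 < 2 * j.val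
        · rw [h2 j hjm x, zero_smul]
        · rcases Nat.lt_or_ge j.val m with hlt | hge
          · rw [(ih j.val hlt j rfl).1, smul_zero]
          · have : j = i := Fin.ext (by omega)
            rw [this, hPi, smul_zero]
      · intro j _ hj
        by_cases hjm : 2 * m + 1 < 2 * j.val + 1
        · rw [h3 j hjm x, zero_smul]
        · rw [(ih j.val (by have : j.val ≠ m := fun e => hj (Fin.ext (by omega)); omega)
            j rfl).2, smul_zero]
  -- conclude `S = ⊤`
  have hmem : ∀ v, S.mkQ v = 0 → v ∈ S := fun v hv => by
    rwa [Submodule.mkQ_apply, Submodule.Quotient.mk_eq_zero] at hv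
  rw [eq_top_iff]
  rintro v -
  rw [eq_sum_unitQ_add_sum_unitP v]
  exact add_mem (Submodule.sum_mem _ fun i _ => Submodule.smul_mem _ _ (hmem _ (key _ i rfl).2))
    (Submodule.sum_mem _ fun i _ => Submodule.smul_mem _ _ (hmem _ (key _ i rfl).1))

end Brackets

/-! ## `σ X_H + c S_B` against a smooth factor times the Gibbs density: the `μ_T`-adjoint -/

section Adjoint

/-- **`∫ (σ X_H f + c S_B f + κ f) g ρ_T = ∫ f (−σ X_H g + c S_B g + κ g) ρ_T`** for `f ∈ C²_c`,
`g ∈ C²`, any site weights `B` and constant `κ` (`C¹` potentials, `T ≠ 0`): `X_H` is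
`ρ_T dx`-antisymmetric and each thermostat `S_i` is `ρ_T dx`-symmetric.
(adapted from `integral_generator_mul_eq_adjoint`, `B = bathWeight`, `κ = 0`) [folklore] -/
theorem integral_genOp_mul_eq_adjoint (hU : ContDiff ℝ 1 P.U) (hV : ContDiff ℝ 1 P.V) (L : ℕ)
    {T : ℝ} (hT : T ≠ 0) (σ c : ℝ) (B : Fin L → ℝ) (κ : ℝ) {f g : PhaseSpace L → ℝ}
    (hf : ContDiff ℝ 2 f) (hfc : HasCompactSupport f) (hg : ContDiff ℝ 2 g) :
    ∫ x, (σ * liouvilleOp P L f x + c * bathOp L B T f x + κ * f x) * (g x * P.gibbsDensity L T x) =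
      ∫ x, f x * ((-σ * liouvilleOp P L g x + c * bathOp L B T g x + κ * g x) *
        P.gibbsDensity L T x) := by
  have hf1 : ContDiff ℝ 1 f := hf.of_le (by norm_num)
  have hg1 : ContDiff ℝ 1 g := hg.of_le (by norm_num)
  have hfd := hf.differentiable two_ne_zero
  have hρc : Continuous (P.gibbsDensity L T) :=
    P.continuous_gibbsDensity hU.continuous hV.continuous L T
  have hfP1 : ∀ i, ContDiff ℝ 1 (partialP i f) := fun i => contDiff_partialP hf (by norm_num) i
  have hPs : ∀ i, HasCompactSupport (partialP i f) := fun i => hasCompactSupport_partialP hfd hfc i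
  have hPPs : ∀ i, HasCompactSupport (partialP i (partialP i f)) := fun i =>
    hasCompactSupport_partialP ((hfP1 i).differentiable one_ne_zero) (hPs i) i
  have hPc : ∀ i, Continuous (partialP i f) := fun i => (hfP1 i).continuous
  have hPPc : ∀ i, Continuous (partialP i (partialP i f)) := fun i =>
    continuous_partialP (hfP1 i) one_ne_zero i
  -- integrable pieces of the left-hand side
  have iL : Integrable (fun x => σ * (liouvilleOp P L f x * (g x * P.gibbsDensity L T x))) := by
    refine Integrable.const_mul ?_ σ
    have : (fun x => liouvilleOp P L f x * (g x * P.gibbsDensity L T x)) =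
        fun x => ∑ i, (x.2 i * partialQ i f x - partialQ i (P.hamiltonian L) x * partialP i f x) *
          (g x * P.gibbsDensity L T x) := by
      funext x; simp only [liouvilleOp, Finset.sum_mul]
    rw [this]
    refine integrable_finsetSum _ fun i _ => ?_
    have hH1 : ContDiff ℝ 1 (P.hamiltonian L) := P.contDiff_hamiltonian hU hV L
    have hQc := continuous_partialQ hf1 one_ne_zero i
    have hWc := P.continuous_partialQ_hamiltonian hH1 i
    refine Continuous.integrable_of_hasCompactSupport (by fun_prop) ?_
    exact (((hasCompactSupport_partialQ hfd hfc i).mul_left (f := fun x : PhaseSpace L => x.2 i)).sub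
      ((hPs i).mul_left)).mul_right
  have iS : ∀ i, Integrable (fun x => c * B i *
      ((T * partialP i (partialP i f) x - x.2 i * partialP i f x) * (g x * P.gibbsDensity L T x))) := by
    intro i
    refine (Continuous.integrable_of_hasCompactSupport (by fun_prop) ?_).const_mul _
    exact (((hPPs i).mul_left).sub ((hPs i).mul_left)).mul_right
  have iK : Integrable (fun x => κ * (f x * (g x * P.gibbsDensity L T x))) :=
    (Continuous.integrable_of_hasCompactSupport (hf.continuous.mul (hg.continuous.mul hρc))
      hfc.mul_right).const_mul _
  -- integrable pieces of the right-hand side (compact support from `f`)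
  have jL : Integrable (fun x => -σ * (f x * (liouvilleOp P L g x * P.gibbsDensity L T x))) :=
    (Continuous.integrable_of_hasCompactSupport
      (hf.continuous.mul ((continuous_liouvilleOp P hU hV hg1).mul hρc)) hfc.mul_right).const_mul _
  have jS : ∀ i, Integrable (fun x => c * B i *
      (f x * ((T * partialP i (partialP i g) x - x.2 i * partialP i g x) * P.gibbsDensity L T x))) := by
    intro i
    have hg1' : ContDiff ℝ 1 (partialP i g) := contDiff_partialP hg (by norm_num) i
    have hgPc := hg1'.continuous
    have hgPPc := continuous_partialP hg1' one_ne_zero i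
    exact (Continuous.integrable_of_hasCompactSupport (by fun_prop) hfc.mul_right).const_mul _
  -- rewrite both sides as sums of integrals
  have lhs : ∫ x, (σ * liouvilleOp P L f x + c * bathOp L B T f x + κ * f x) *
        (g x * P.gibbsDensity L T x) =
      σ * (∫ x, liouvilleOp P L f x * (g x * P.gibbsDensity L T x)) +
        (∑ i, ∫ x, c * B i *
          ((T * partialP i (partialP i f) x - x.2 i * partialP i f x) * (g x * P.gibbsDensity L T x))) +
        κ * ∫ x, f x * (g x * P.gibbsDensity L T x) := by
    have iLS : Integrable (fun x => σ * (liouvilleOp P L f x * (g x * P.gibbsDensity L T x)) +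
        ∑ i, c * B i * ((T * partialP i (partialP i f) x - x.2 i * partialP i f x) *
          (g x * P.gibbsDensity L T x))) := iL.add (integrable_finsetSum _ fun i _ => iS i)
    rw [← integral_finsetSum _ fun i _ => iS i, ← integral_const_mul, ← integral_const_mul,
      ← integral_add iL (integrable_finsetSum _ fun i _ => iS i), ← integral_add iLS iK]
    refine integral_congr_ae (ae_of_all _ fun x => ?_)
    have e : c * bathOp L B T f x =
        ∑ i, c * B i * (T * partialP i (partialP i f) x - x.2 i * partialP i f x) := by
      unfold bathOp
      rw [Finset.mul_sum]
      exact Finset.sum_congr rfl fun i _ => by ring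
    dsimp only
    rw [add_mul, e, add_mul, Finset.sum_mul]
    congr 1
    · congr 1
      · ring
      · exact Finset.sum_congr rfl fun i _ => by ring
    · ring
  have rhs : ∫ x, f x * ((-σ * liouvilleOp P L g x + c * bathOp L B T g x + κ * g x) *
        P.gibbsDensity L T x) =
      -σ * (∫ x, f x * (liouvilleOp P L g x * P.gibbsDensity L T x)) +
        (∑ i, ∫ x, c * B i *
          (f x * ((T * partialP i (partialP i g) x - x.2 i * partialP i g x) * P.gibbsDensity L T x))) +
        κ * ∫ x, f x * (g x * P.gibbsDensity L T x) := by
    have jLS : Integrable (fun x => -σ * (f x * (liouvilleOp P L g x * P.gibbsDensity L T x)) +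
        ∑ i, c * B i * (f x * ((T * partialP i (partialP i g) x - x.2 i * partialP i g x) *
          P.gibbsDensity L T x))) := jL.add (integrable_finsetSum _ fun i _ => jS i)
    rw [← integral_finsetSum _ fun i _ => jS i, ← integral_const_mul, ← integral_const_mul,
      ← integral_add jL (integrable_finsetSum _ fun i _ => jS i), ← integral_add jLS iK]
    refine integral_congr_ae (ae_of_all _ fun x => ?_)
    have e : c * bathOp L B T g x =
        ∑ i, c * B i * (T * partialP i (partialP i g) x - x.2 i * partialP i g x) := by
      unfold bathOp
      rw [Finset.mul_sum]
      exact Finset.sum_congr rfl fun i _ => by ring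
    dsimp only
    rw [add_mul, mul_add, e, add_mul, Finset.sum_mul, mul_add, Finset.mul_sum]
    congr 1
    · congr 1
      · ring
      · exact Finset.sum_congr rfl fun i _ => by ring
    · ring
  rw [lhs, rhs, integral_liouvilleOp_mul P hU hV L T hf1 hfc hg1]
  congr 1
  congr 1
  · ring
  · refine Finset.sum_congr rfl fun i _ => ?_
    rw [integral_const_mul, integral_const_mul, integral_thermo_site_symm P hU hV L hT i hf hfc hg]

end Adjoint

/-- Registered helper sub-goal `helper_dffBrackets` of stub `stub_deviceForwardFields`: the bracket condition for general site weights (= `isBracketGenerating_genFamily` in stub form). [folklore] -/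
theorem helper_dffBrackets : ∀ (P : OscillatorChain) (L : ℕ) (hL : 0 < L) (σ c T : ℝ) (B : Fin L → ℝ), ContDiff ℝ ∞ P.U → ContDiff ℝ ∞ P.V → σ ≠ 0 → 0 < c * T * B ⟨0, hL⟩ → (∀ r, deriv (deriv P.V) r ≠ 0) → Literature.Analysis.Distribution.IsBracketGenerating (fun o : Option (Fin L) => Option.elim o (fun x : PhaseSpace L => σ • Summit.AtomisticToContinuum.FouriersLaw.Theorems.SuperadditiveResistance.DeviceLiouville.hamField P L x + c • (((0 : Fin L → ℝ), B * Prod.snd x) : PhaseSpace L)) (fun (i : Fin L) (_x : PhaseSpace L) => Real.sqrt (c * T * B i) • (unitP i : PhaseSpace L))) Set.univ :=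
  fun _ _ hL σ c T B hU hV hσ hB0 hV2 => isBracketGenerating_genFamily hL σ c T B hU hV hσ hB0 hV2

end Summit.AtomisticToContinuum.FouriersLaw.Cruxes.SuperadditiveResistance.FloatingProbeBypassLaplacian

end
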